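import Literature.NumberTheory.LFunctions.RiemannHypothesisUpToRSCertificate
import Literature.NumberTheory.LFunctions.SubnormalZetaGapsLOneLowerBound
import HarnessLib

/-!
# A kernel-certified close pair of zeros of `ζ` on the critical line below height `2001`
# (the numerical input `(closeCriticalZeros 2001).Nonempty` of the Conrey–Iwaniec chain)

Topic `Literature/NumberTheory/LFunctions` (with `Analysis/ValidatedNumerics`). Cell `landau-siegel`
(LANDAU–SIEGEL PROGRAMME, rung F-S3, §C harvest r6 / START-HERE SH-077, edge E*-ℓ). The tree's
conditional endgame "RH + Montgomery's pair correlation ⇒ Conrey–Iwaniec's hypothesis (1.22) ⇒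
`L(1,χ) ≫ (log q)^{−90}`" (`Literature.NumberTheory.LFunctions.BGMM2023.subnormalGapsHypothesis_of_eventually`,
`ZetaSpacingDensityRH.lean`; `Literature.NumberTheory.LFunctions.subnormalGapsHypothesis_of_pairCorrelation` and
`lOne_lower_bound_of_pairCorrelation`, `PairCorrelationSubnormalGaps.lean`) carries ONE numerical
hypothesis, `(Literature.NumberTheory.LFunctions.closeCriticalZeros 2001).Nonempty`: some zero
`½ + iγ` of `ζ` with `0 < γ ≤ 2001` has a critical zero `½ + iγ′`, `γ′ ≠ γ`, within
`(π/log γ)(1 − 1/√log γ)` (`Literature.NumberTheory.LFunctions.HasCloseCriticalNeighbour`,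
[ConreyIwaniec2002, Theorem 1.2 (1.22)]). This file discharges it — modulo the same named fact
that every Riemann–Siegel certificate of the tree uses, Gabcke's remainder bound
`Literature.NumberTheory.LFunctions.Gabcke.satz322b_R0` [Gabcke1979, Satz 3.2.2 (b)] — with the
pair `γ₉₉₆ ≈ 1415.5858`, `γ₉₉₇ ≈ 1415.7816` (gap `≈ 0.196`, radius `≈ 0.272`), one of the seven
pairs below `2001` found and Arb-certified by the cell's numerics seats (ls-num-2, kit j256438,
`pub/landau-siegel/num/num-2/ZETA-CLOSE-PAIRS-2001.md`; twin ls-num-1, kit j256472); here the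
certificate is re-done INSIDE the kernel:

* three certified signs of Hardy's `Z` at the dyadic points `1449529/2¹⁰ ≈ 1415.5557` (`Z > 0`),
  `1449660/2¹⁰ ≈ 1415.6836` (`Z < 0`), `1449791/2¹⁰ ≈ 1415.8115` (`Z > 0`), each by the executable
  check `Literature.NumberTheory.LFunctions.RSCert.checkStart` (Riemann–Siegel main sum of length
  `N = 15`, `decide +kernel`) and its soundness `RSCert.sgnZ_of_checkStart` [Brent1979, §3];
  `|Z| ≥ 0.039` at the three points against an enclosure radius `< 10⁻³`;
* two sign changes ⇒ two zeros `γ < 1449660/2¹⁰ < γ′` of `Z` (intermediate value theorem,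
  `continuous_hardyZ`), i.e. of `ζ(½ + it)` (`hardyZ_eq_zero_iff_holds`), with
  `γ′ − γ ≤ 262/2¹⁰ < 0.2559`;
* the radius: `7 ≤ log γ ≤ 7.4` (from `e⁷ < 1097` and `e^{7.4} > 1535`, Mathlib's decimal bounds
  on `e`), so `(π/log γ)(1 − 1/√log γ) ≥ (π/7.4)(1 − 1/√7) > 0.264 > 0.2559`.

Nothing else is assumed; no statement about Landau–Siegel zeros is made here («the programme
SEARCHES and TYPES; no claim about Landau–Siegel zeros, Theorems 1–2 of arXiv:2211.02515 or a
repaired Margin232 until a kernel theorem says so»).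

## References

* [ConreyIwaniec2002] B. Conrey, H. Iwaniec, Acta Arith. 103 (2002), Theorem 1.2 (1.22).
* [Brent1979] R. P. Brent, Math. Comp. 33 (1979), §3 (sign changes of `Z`).
* [Gabcke1979] W. Gabcke, Dissertation Göttingen 1979, Satz 3.2.2 (b).
-/

noncomputable section

open Complex Set
open Literature.NumberTheory.LFunctions.RSCert

namespace Literature.NumberTheory.LFunctions

namespace CloseCriticalZerosWitness

/-- `Z(1449529/2¹⁰) > 0` (`t ≈ 1415.5557`, Riemann–Siegel with `N = 15`, kernel-checked).
[cite: Brent1979, §3] -/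
theorem sign₁ : checkStart 15 32 12 10 15 1449529 true = true := by
  decide +kernel

/-- `Z(1449660/2¹⁰) < 0` (`t ≈ 1415.6836`). [cite: Brent1979, §3] -/
theorem sign₂ : checkStart 15 32 12 10 15 1449660 false = true := by
  decide +kernel

/-- `Z(1449791/2¹⁰) > 0` (`t ≈ 1415.8115`). [cite: Brent1979, §3] -/
theorem sign₃ : checkStart 15 32 12 10 15 1449791 true = true := by
  decide +kernel

/-- `e⁷ < 1097`. [folklore] -/
private theorem exp_seven_lt : Real.exp 7 < 1097 := by
  have h := Real.exp_one_lt_d9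
  have h7 : Real.exp 7 = Real.exp 1 ^ 7 := by
    rw [← Real.exp_nat_mul]; norm_num
  rw [h7]
  calc Real.exp 1 ^ 7 < (2.7182818286 : ℝ) ^ 7 :=
        pow_lt_pow_left₀ h (Real.exp_pos 1).le (by norm_num)
    _ < 1097 := by norm_num

/-- `1535 < e^{37/5}`. [folklore] -/
private theorem lt_exp_seven_point_four : (1535 : ℝ) < Real.exp (37 / 5) := by
  have h := Real.exp_one_gt_d9
  have hsplit : Real.exp (37 / 5) = Real.exp 1 ^ 7 * Real.exp (2 / 5) := by
    rw [← Real.exp_nat_mul, ← Real.exp_add]; norm_num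
  rw [hsplit]
  have h1 : (2.7182818283 : ℝ) ^ 7 < Real.exp 1 ^ 7 :=
    pow_lt_pow_left₀ h (by norm_num) (by norm_num)
  have h2 : (2 / 5 : ℝ) + 1 ≤ Real.exp (2 / 5) := Real.add_one_le_exp _
  have h3 : (1096 : ℝ) < (2.7182818283 : ℝ) ^ 7 := by norm_num
  nlinarith [Real.exp_pos (2 / 5 : ℝ)]

/-- The radius bound on `[e⁷, e^{7.4}]`: if `7 ≤ log γ ≤ 37/5` then `ciRadius γ > 262/1024`.
[cite: ConreyIwaniec2002, Theorem 1.2 (1.22)] -/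
theorem ciRadius_gt {γ : ℝ} (hlo : 7 ≤ Real.log γ) (hhi : Real.log γ ≤ 37 / 5) :
    (262 : ℝ) / 1024 < ciRadius γ := by
  have hlogpos : 0 < Real.log γ := by linarith
  have hsqrt : (2645 / 1000 : ℝ) ≤ Real.sqrt (Real.log γ) :=
    Real.le_sqrt_of_sq_le (by nlinarith)
  have hfac1 : Real.pi / (37 / 5) ≤ Real.pi / Real.log γ :=
    div_le_div_of_nonneg_left Real.pi_pos.le hlogpos hhi
  have hfac2 : 1 - 1 / (2645 / 1000 : ℝ) ≤ 1 - 1 / Real.sqrt (Real.log γ) := by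
    have : 1 / Real.sqrt (Real.log γ) ≤ 1 / (2645 / 1000 : ℝ) :=
      one_div_le_one_div_of_le (by norm_num) hsqrt
    linarith
  have hpi := Real.pi_gt_d6
  have hnum : (262 : ℝ) / 1024 < Real.pi / (37 / 5) * (1 - 1 / (2645 / 1000 : ℝ)) := by
    have : Real.pi / (37 / 5) * (1 - 1 / (2645 / 1000 : ℝ)) = Real.pi * (1645 / 19573) := by ring
    rw [this]; nlinarith
  calc (262 : ℝ) / 1024 < Real.pi / (37 / 5) * (1 - 1 / (2645 / 1000 : ℝ)) := hnum
    _ ≤ Real.pi / Real.log γ * (1 - 1 / Real.sqrt (Real.log γ)) :=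
        mul_le_mul hfac1 hfac2 (by norm_num) (by positivity)

end CloseCriticalZerosWitness

open CloseCriticalZerosWitness

/-- **A close pair of critical zeros below height 2001 (kernel certificate, modulo Gabcke's
Riemann–Siegel remainder bound).** There are zeros `½ + iγ`, `½ + iγ′` of `ζ` with
`1415.55 < γ < 1415.69 < γ′ < 1415.82`, hence `0 < γ′ − γ ≤ 262/1024 < (π/log γ)(1 − 1/√log γ)`;
in particular `γ ∈ closeCriticalZeros 2001`, discharging the hypothesis
`(closeCriticalZeros 2001).Nonempty` of `BGMM2023.subnormalGapsHypothesis_of_eventually` and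
`subnormalGapsHypothesis_of_pairCorrelation`.
[cite: ConreyIwaniec2002, Theorem 1.2 (1.22)] [cite: Gabcke1979, Satz 3.2.2 (b) p. 55] -/
theorem closeCriticalZeros_2001_nonempty (hG : Gabcke.satz322b_R0) :
    (closeCriticalZeros 2001).Nonempty := by
  -- the three certified signs
  have h1 : 0 < hardyZ ((1449529 : ℝ) / 1024) := by
    have := sgnZ_of_checkStart hG sign₁; norm_num [sgnZ] at this; exact this
  have h2 : hardyZ ((362415 : ℝ) / 256) < 0 := by
    have := sgnZ_of_checkStart hG sign₂; norm_num [sgnZ] at this; exact this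
  have h3 : 0 < hardyZ ((1449791 : ℝ) / 1024) := by
    have := sgnZ_of_checkStart hG sign₃; norm_num [sgnZ] at this; exact this
  -- two zeros of `Z` by the intermediate value theorem
  obtain ⟨γ, ⟨hγa, hγm⟩, hγ0⟩ : ∃ γ ∈ Icc ((1449529 : ℝ) / 1024) ((362415 : ℝ) / 256), hardyZ γ = 0 :=
    intermediate_value_Icc' (by norm_num) continuous_hardyZ.continuousOn ⟨h2.le, h1.le⟩
  obtain ⟨γ', ⟨hγ'm, hγ'b⟩, hγ'0⟩ : ∃ γ' ∈ Icc ((362415 : ℝ) / 256) ((1449791 : ℝ) / 1024), hardyZ γ' = 0 :=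
    intermediate_value_Icc (by norm_num) continuous_hardyZ.continuousOn ⟨h2.le, h3.le⟩
  have hγ_lt : γ < (362415 : ℝ) / 256 := lt_of_le_of_ne hγm fun h ↦ by
    rw [h] at hγ0; exact h2.ne hγ0
  have hγ'_gt : (362415 : ℝ) / 256 < γ' := lt_of_le_of_ne hγ'm fun h ↦ by
    rw [← h] at hγ'0; exact h2.ne hγ'0
  have hne : γ' ≠ γ := by
    intro h; rw [h] at hγ'_gt; exact lt_irrefl _ (hγ_lt.trans hγ'_gt)
  -- logarithm bounds for `γ`
  have hγpos : 0 < γ := by linarith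
  have hlo : 7 ≤ Real.log γ := by
    rw [Real.le_log_iff_exp_le hγpos]
    linarith [exp_seven_lt]
  have hhi : Real.log γ ≤ 37 / 5 := by
    rw [Real.log_le_iff_le_exp hγpos]
    linarith [lt_exp_seven_point_four]
  have hrad := ciRadius_gt hlo hhi
  refine ⟨γ, hγpos, by linarith, (hardyZ_eq_zero_iff_holds γ).1 hγ0, Or.inr ⟨γ', hne,
    (hardyZ_eq_zero_iff_holds γ').1 hγ'0, ?_⟩⟩
  rw [abs_sub_comm, abs_of_pos (by linarith)]
  linarith

end Literature.NumberTheory.LFunctions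

end
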